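import Mathlib
import Literature.Computability.Complexity.RangeAvoidance
import Literature.Computability.Complexity.SignDegreeXor
import Summits.PneNP.PneNP.Theorems.PstarPDT
import Summits.PneNP.PneNP.Theorems.PstarSALevel
import Summits.PneNP.PneNP.Theorems.PstarTyped
import Summits.PneNP.PneNP.Theorems.PstarFibrePolys
import Summits.PneNP.PneNP.Theorems.PstarPDTUpper
import Summits.PneNP.PneNP.Theorems.PstarGapLemma

/-!
# The gap lemma as first typed is false: `¬ PstarGapLemma` by the couples gadget (ROUND-24 item T24.8d)

FRONTIER range-avoidance ladder, rung F-N3, ROUND 24 (cell `pnp-ideate`; restricted-model proof complexity — nothing here bears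
on `P` versus `NP`).  NEGATIVE EDGE of the gap route: the first typing `PstarGapLemma.PstarGapLemma` (no `SimpleOverlap`
hypothesis) is refuted; the live crux is `PstarGapLemma.PstarGapLemmaSO` (planner p3, same day), which the witness below does
NOT touch (its couples share a whole AND pair, violating `SimpleOverlap` — `not_simpleOverlap_gad`).

**The couples gadget `gad K`** (`K` couples; `n = 6K` variables, `m = 2K` outputs).  Output `j < 2K` reads the XOR slots
`x_{j,0} = 2j`, `x_{j,1} = 2j+1` and the AND pair `a_{i,0} = 4K+2i`, `a_{i,1} = 4K+2i+1` of its couple `i = ⌊j/2⌋`, with the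
`P⋆` predicate `x ⊕ x' ⊕ (a ∧ a')`.  It is pure (`gad_isPure`), typed (`gad_typed`: XOR slots `< 4K ≤` AND slots),
`(r, 3/2)`-boundary expanding for EVERY `r` (`gad_boundaryExpanding`: the two XOR variables of each output are private, so
`|bdry J| ≥ 2|J|`), and of maximum degree `2` (`gad_maxDegree`).

**The kill.**  Target `y = 0`, ONE dense constraint `W = {⊕_{all 4K XOR variables} = 1}`, `J =` all `2K` outputs.  Infeasible
(`not_feasible_univ`): in `𝔽₂`, `Σ_j P⋆_j(z) = Σ_{XOR variables} z_v + Σ_j a_{⌊j/2⌋,0} a_{⌊j/2⌋,1}` and the products cancel in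
couples (`sum_ninvolution` over the partner map), so all outputs `= 0` forces the XOR parity to be `0 ≠ 1`.  Minimal
(`feasible_erase`): dropping output `j₀`, the assignment "only `x_{j₀,0}` true" meets every other output (`0 ⊕ 0 ⊕ 0·0 = 0`) and the
parity.  Hence `MinInfeasible` with `|J| = 2K > K = K·|W|`: `GapBound K (2K)` fails at `Δ = 2` for every `K > 0`
(`not_pstarGapLemma`).  Classification: refuted-MISSTATED — the repaired statement is `PstarGapLemmaSO` (adds `SimpleOverlap I`),
and the witness misses it (`not_simpleOverlap_gad`).
-/

set_option linter.dupNamespace false -- `Summit.PneNP.PneNP.…`: summit = sub-problem name (D-0017 single-conjunct layout)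

open Finset Literature.Computability.Complexity
open Summit.PneNP.PneNP.Theorems.PstarPDT (parity bit_eval)
open Summit.PneNP.PneNP.Theorems.PstarTyped (Typed)
open Summit.PneNP.PneNP.Theorems.PstarSALevel (varSet bdry BoundaryExpanding SimpleOverlap)
open Summit.PneNP.PneNP.Theorems.PstarFibrePolys (bit)
open Summit.PneNP.PneNP.Theorems.PstarGapLemma (Sat Feasible MinInfeasible GapBound MaxDegree PstarGapLemma)

namespace Summit.PneNP.PneNP.Theorems.PstarGapLemmaRefutation

variable (K : ℕ)

/-! ## The gadget -/

/-- XOR variable `x_{j,e}` = position `2j + e` (`j < 2K`, `e < 2`). -/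
def xv (p : Fin (2 * K) × Fin 2) : Fin (6 * K) :=
  ⟨2 * p.1.val + p.2.val, by have := p.1.isLt; have := p.2.isLt; omega⟩

/-- AND variable `a_{i,e}` = position `4K + 2i + e` (`i < K`, `e < 2`). -/
def av (q : Fin K × Fin 2) : Fin (6 * K) :=
  ⟨4 * K + 2 * q.1.val + q.2.val, by have := q.1.isLt; have := q.2.isLt; omega⟩

/-- The couple `⌊j/2⌋` of output `j`. -/
def half (j : Fin (2 * K)) : Fin K := ⟨j.val / 2, by have := j.isLt; omega⟩

/-- The partner output of `j` in its couple (`2i ↔ 2i+1`). -/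
def partner (j : Fin (2 * K)) : Fin (2 * K) :=
  ⟨if j.val % 2 = 0 then j.val + 1 else j.val - 1, by have := j.isLt; split_ifs <;> omega⟩

/-- **The couples gadget**: output `j` reads `x_{j,0}, x_{j,1}` (XOR slots) and `a_{⌊j/2⌋,0}, a_{⌊j/2⌋,1}` (AND slots, shared with
its partner), predicate `P⋆ = x ⊕ x' ⊕ (a ∧ a')`. -/
def gad : LocalMap 4 (6 * K) (2 * K) where
  vars j := ![xv K (j, 0), xv K (j, 1), av K (half K j, 0), av K (half K j, 1)]
  table _ := xorAndPred

/-- The set of all `4K` XOR variables. -/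
def SX : Finset (Fin (6 * K)) := univ.image (xv K)

/-- Slot `0` of output `j` is `x_{j,0}`. -/
@[simp] theorem vars_zero (j : Fin (2 * K)) : (gad K).vars j 0 = xv K (j, 0) := rfl

/-- Slot `1` of output `j` is `x_{j,1}`. -/
@[simp] theorem vars_one (j : Fin (2 * K)) : (gad K).vars j 1 = xv K (j, 1) := rfl

/-- Slot `2` of output `j` is `a_{⌊j/2⌋,0}`. -/
@[simp] theorem vars_two (j : Fin (2 * K)) : (gad K).vars j 2 = av K (half K j, 0) := rfl

/-- Slot `3` of output `j` is `a_{⌊j/2⌋,1}`. -/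
@[simp] theorem vars_three (j : Fin (2 * K)) : (gad K).vars j 3 = av K (half K j, 1) := rfl

/-- `x_{j,e}` determines `(j, e)`. -/
theorem xv_injective : Function.Injective (xv K) := by
  rintro ⟨j, e⟩ ⟨j', e'⟩ h
  simp only [xv, Fin.mk.injEq] at h
  have := e.isLt
  have := e'.isLt
  have hj : j = j' := Fin.ext (by omega)
  have he : e = e' := Fin.ext (by omega)
  rw [hj, he]

/-- XOR variables lie below `4K`. -/
theorem xv_lt (p : Fin (2 * K) × Fin 2) : (xv K p).val < 4 * K := by
  have := p.1.isLt; have := p.2.isLt; simp only [xv]; omega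

/-- AND variables lie at or above `4K`. -/
theorem le_av (q : Fin K × Fin 2) : 4 * K ≤ (av K q).val := by
  simp only [av]; omega

/-- An XOR variable is never an AND variable. -/
theorem xv_ne_av (p : Fin (2 * K) × Fin 2) (q : Fin K × Fin 2) : xv K p ≠ av K q := by
  intro h
  have h1 := xv_lt K p
  have h2 := le_av K q
  rw [h] at h1
  omega

/-- The variables read by output `j`. -/
theorem mem_varSet_iff (j : Fin (2 * K)) (v : Fin (6 * K)) :
    v ∈ varSet (gad K) j ↔ v = xv K (j, 0) ∨ v = xv K (j, 1) ∨ v = av K (half K j, 0) ∨ v = av K (half K j, 1) := by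
  unfold varSet
  simp only [mem_image, mem_univ, true_and]
  constructor
  · rintro ⟨s, hs⟩
    fin_cases s
    · exact Or.inl hs.symm
    · exact Or.inr (Or.inl hs.symm)
    · exact Or.inr (Or.inr (Or.inl hs.symm))
    · exact Or.inr (Or.inr (Or.inr hs.symm))
  · rintro (rfl | rfl | rfl | rfl)
    exacts [⟨0, rfl⟩, ⟨1, rfl⟩, ⟨2, rfl⟩, ⟨3, rfl⟩]

/-- The XOR variable `x_{j,e}` is read by output `j` only. -/
theorem xv_mem_varSet_iff (p : Fin (2 * K) × Fin 2) (j' : Fin (2 * K)) : xv K p ∈ varSet (gad K) j' ↔ j' = p.1 := by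
  rw [mem_varSet_iff]
  constructor
  · rintro (h | h | h | h)
    · exact (congrArg Prod.fst (xv_injective K h)).symm
    · exact (congrArg Prod.fst (xv_injective K h)).symm
    · exact absurd h (xv_ne_av K _ _)
    · exact absurd h (xv_ne_av K _ _)
  · rintro rfl
    rcases p with ⟨j, e⟩
    fin_cases e
    · exact Or.inl rfl
    · exact Or.inr (Or.inl rfl)

/-! ## The four hypotheses of the gap lemma -/

/-- The gadget is a pure `P⋆` instance. -/
theorem gad_isPure : (gad K).IsPure xorAndPred := by
  refine ⟨fun _ => rfl, fun j => ?_⟩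
  intro s t h
  have hx : ∀ e e' : Fin 2, xv K (j, e) = xv K (j, e') → e = e' := fun e e' h => congrArg Prod.snd (xv_injective K h)
  have ha : ∀ e e' : Fin 2, av K (half K j, e) = av K (half K j, e') → e = e' := by
    intro e e' h
    simp only [av, Fin.mk.injEq] at h
    exact Fin.ext (by omega)
  fin_cases s <;> fin_cases t
  all_goals first
    | rfl
    | exact absurd (hx _ _ h) (by decide)
    | exact absurd (ha _ _ h) (by decide)
    | exact absurd h (xv_ne_av K _ _)
    | exact absurd h.symm (xv_ne_av K _ _)

/-- The gadget is typed: XOR slots read positions `< 4K`, AND slots positions `≥ 4K`. -/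
theorem gad_typed : Typed (gad K) := by
  intro j j' s s' hs hs' h
  have h1 : ((gad K).vars j s).val < 4 * K := by
    fin_cases s
    · exact xv_lt K _
    · exact xv_lt K _
    · simp at hs
    · simp at hs
  have h2 : 4 * K ≤ ((gad K).vars j' s').val := by
    fin_cases s'
    · simp at hs'
    · simp at hs'
    · exact le_av K _
    · exact le_av K _
  rw [h] at h1
  omega

/-- The gadget is `(r, 3/2)`-boundary expanding for every `r`: the two XOR variables of each output of `J` are boundary
variables of `J`, so `|bdry J| ≥ 2|J|`. -/
theorem gad_boundaryExpanding (r : ℕ) : BoundaryExpanding r (gad K) := by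
  intro J _
  have h : (J ×ˢ (univ : Finset (Fin 2))).card ≤ (bdry (gad K) J).card := by
    apply card_le_card_of_injOn (xv K)
    · intro p hp
      have hp' : p.1 ∈ J := (mem_product.mp (mem_coe.mp hp)).1
      rw [mem_coe]
      unfold bdry
      rw [mem_filter, card_eq_one]
      refine ⟨mem_univ _, p.1, ?_⟩
      ext j'
      rw [mem_filter, mem_singleton, xv_mem_varSet_iff]
      constructor
      · rintro ⟨-, h⟩; exact h
      · rintro rfl; exact ⟨hp', rfl⟩
    · exact fun a _ b _ hab => xv_injective K hab
  rw [card_product, card_univ, Fintype.card_fin] at h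
  omega

/-- The gadget has maximum variable degree `2`: an XOR variable is read by one output, an AND variable by the two outputs of its
couple. -/
theorem gad_maxDegree : MaxDegree 2 (gad K) := by
  intro v
  by_cases hv : v.val < 4 * K
  · have hj : v.val / 2 < 2 * K := by omega
    refine (card_le_card (t := {⟨v.val / 2, hj⟩}) ?_).trans (by simp)
    intro j hjm
    rw [mem_filter] at hjm
    rw [mem_singleton, Fin.ext_iff]
    show j.val = v.val / 2
    rcases (mem_varSet_iff K j v).1 hjm.2 with h | h | h | h
    · rw [h]; simp only [xv]; omega
    · rw [h]; simp only [xv, Fin.val_one]; omega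
    · exact absurd (h ▸ hv) (by have := le_av K (half K j, 0); omega)
    · exact absurd (h ▸ hv) (by have := le_av K (half K j, 1); omega)
  · have hvlt := v.isLt
    have h0 : 2 * ((v.val - 4 * K) / 2) < 2 * K := by omega
    have h1 : 2 * ((v.val - 4 * K) / 2) + 1 < 2 * K := by omega
    refine (card_le_card (t := {⟨_, h0⟩, ⟨_, h1⟩}) ?_).trans Finset.card_le_two
    intro j hjm
    rw [mem_filter] at hjm
    rw [mem_insert, mem_singleton, Fin.ext_iff, Fin.ext_iff]
    show j.val = 2 * ((v.val - 4 * K) / 2) ∨ j.val = 2 * ((v.val - 4 * K) / 2) + 1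
    rcases (mem_varSet_iff K j v).1 hjm.2 with h | h | h | h
    · exact absurd (h ▸ xv_lt K (j, 0)) hv
    · exact absurd (h ▸ xv_lt K (j, 1)) hv
    · rw [h]; simp only [av, half]; omega
    · rw [h]; simp only [av, half, Fin.val_one]; omega

/-! ## The minimal infeasible set -/

/-- In `𝔽₂`, `x + x = 0`. -/
private theorem zmod2_add_self (x : ZMod 2) : x + x = 0 := by
  revert x; decide

/-- **Infeasible.**  With target `0` and the single constraint "parity of all XOR variables `= 1`", the set of all outputs is
infeasible: summing the `2K` output equations in `𝔽₂`, the AND products cancel in couples and the XOR parity would be `0`. -/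
theorem not_feasible_univ : ¬ Feasible (gad K) (fun _ => false) {(SX K, true)} univ := by
  rintro ⟨z, hW, hJ⟩
  have hpar : parity (SX K) z = true := hW (SX K, true) (mem_singleton_self _)
  -- (1) the constraint in `𝔽₂`
  have h1 : ∑ v ∈ SX K, bit (z v) = 1 := by
    have hodd : Odd ((SX K).filter (fun v => z v = true)).card := by
      unfold parity at hpar
      exact of_decide_eq_true hpar
    have hs : ∑ v ∈ SX K, bit (z v) = ((((SX K).filter (fun v => z v = true)).card : ℕ) : ZMod 2) := by
      rw [← sum_boole]
      rfl
    rw [hs]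
    exact ZMod.natCast_eq_one_iff_odd.2 hodd
  -- (2) every output equation in `𝔽₂`
  have h2 : ∀ j : Fin (2 * K), bit (z (xv K (j, 0))) + bit (z (xv K (j, 1))) +
      bit (z (av K (half K j, 0))) * bit (z (av K (half K j, 1))) = 0 := by
    intro j
    have e := bit_eval (gad_isPure K) z j
    rw [hJ j (mem_univ j), show bit false = 0 from rfl, vars_zero, vars_one, vars_two, vars_three] at e
    exact e.symm
  -- (3) the AND products cancel in couples
  have h3 : ∑ j : Fin (2 * K), bit (z (av K (half K j, 0))) * bit (z (av K (half K j, 1))) = 0 := by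
    refine sum_ninvolution (partner K) ?_ ?_ (fun _ => mem_univ _) ?_
    · intro j
      have hh : half K (partner K j) = half K j := by
        simp only [half, partner, Fin.mk.injEq]
        split_ifs <;> omega
      rw [hh]
      exact zmod2_add_self _
    · intro j _
      rw [ne_eq, Fin.ext_iff]
      simp only [partner]
      split_ifs <;> omega
    · intro j
      rw [Fin.ext_iff]
      simp only [partner]
      split_ifs <;> omega
  -- (4) the XOR variables, output by output
  have h4 : ∑ v ∈ SX K, bit (z v) = ∑ j : Fin (2 * K), (bit (z (xv K (j, 0))) + bit (z (xv K (j, 1)))) := by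
    unfold SX
    rw [sum_image fun a _ b _ hab => xv_injective K hab, Fintype.sum_prod_type]
    simp only [Fin.sum_univ_two]
  -- (5) combine
  have h5 : ∑ j : Fin (2 * K), (bit (z (xv K (j, 0))) + bit (z (xv K (j, 1)))) = 0 := by
    have := Finset.sum_eq_zero fun j (_ : j ∈ (univ : Finset (Fin (2 * K)))) => h2 j
    rwa [sum_add_distrib, h3, add_zero] at this
  rw [h4, h5] at h1
  exact zero_ne_one h1

/-- **Minimal.**  Dropping any output `j₀`, the assignment "only `x_{j₀,0}` is true" satisfies every other output (value
`0 ⊕ 0 ⊕ 0·0 = 0`) and the parity constraint. -/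
theorem feasible_erase (j₀ : Fin (2 * K)) : Feasible (gad K) (fun _ => false) {(SX K, true)} (univ.erase j₀) := by
  classical
  refine ⟨fun v => decide (v = xv K (j₀, 0)), ?_, ?_⟩
  · intro e he
    rw [mem_singleton] at he
    subst he
    show parity (SX K) _ = true
    unfold parity
    rw [decide_eq_true_eq]
    have hf : (SX K).filter (fun v => decide (v = xv K (j₀, 0)) = true) = {xv K (j₀, 0)} := by
      ext v
      simp only [mem_filter, mem_singleton, decide_eq_true_eq, SX, mem_image, mem_univ, true_and]
      constructor
      · rintro ⟨-, h⟩; exact h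
      · rintro rfl; exact ⟨⟨_, rfl⟩, rfl⟩
    rw [hf, card_singleton]
    exact odd_one
  · intro j hj
    have hne : j ≠ j₀ := (mem_erase.mp hj).1
    have h0 : xv K (j, 0) ≠ xv K (j₀, 0) := fun h => hne (congrArg Prod.fst (xv_injective K h))
    have h1 : xv K (j, 1) ≠ xv K (j₀, 0) := fun h => by
      have := congrArg Prod.snd (xv_injective K h)
      simp at this
    have h2 : av K (half K j, 0) ≠ xv K (j₀, 0) := fun h => xv_ne_av K _ _ h.symm
    have h3 : av K (half K j, 1) ≠ xv K (j₀, 0) := fun h => xv_ne_av K _ _ h.symm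
    show xorAndPred (fun s => decide ((gad K).vars j s = xv K (j₀, 0))) = false
    rw [xorAndPred_apply, vars_zero, vars_one, vars_two, vars_three]
    simp [h0, h1, h2, h3]

/-- The set of all `2K` outputs is a MINIMAL infeasible set for the one-constraint system. -/
theorem minInfeasible_univ : MinInfeasible (gad K) (fun _ => false) {(SX K, true)} univ :=
  ⟨not_feasible_univ K, fun j _ => feasible_erase K j⟩

/-- Hence `GapBound K (2K)` fails for the gadget at target `0` whenever `K > 0` (`|J| = 2K > K·1`). -/
theorem not_gapBound (hK : 0 < K) : ¬ GapBound K (2 * K) (gad K) (fun _ => false) := by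
  intro hG
  have h := hG {(SX K, true)} univ (by simp) (minInfeasible_univ K)
  simp only [card_univ, Fintype.card_fin, card_singleton, mul_one] at h
  omega

/-! ## The refutation, and the witness misses the repaired statement -/

/-- **T24.8d — `PstarGapLemma` as first typed is FALSE** (refuted-misstated).  At `Δ = 2`, for the promised `K > 0` the couples
gadget `gad K` (`n = 6K`, `m = r = 2K`) is pure, typed, `(r,3/2)`-boundary expanding and of maximum degree `2`, yet with target
`0` and the single constraint "parity of all XOR variables `= 1`" the set of all `2K` outputs is minimal infeasible:
`2K ≤ K·1` is absurd.  Repaired statement: `PstarGapLemma.PstarGapLemmaSO` (adds `SimpleOverlap I`); the witness violates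
`SimpleOverlap` (`not_simpleOverlap_gad`).  FRONTIER negative knowledge; nothing here bears on `P` versus `NP`. -/
theorem not_pstarGapLemma : ¬ PstarGapLemma := by
  intro h
  obtain ⟨K, hK, hG⟩ := h 2
  exact not_gapBound K hK (hG (6 * K) (2 * K) (2 * K) (gad K) (gad_isPure K) (gad_typed K)
    (gad_boundaryExpanding K (2 * K)) (gad_maxDegree K) fun _ => false)

/-- The witness misses the repaired statement: for `K > 0` the gadget violates `SimpleOverlap` (outputs `0` and `1` share the
whole AND pair `a_{0,0}, a_{0,1}`). -/
theorem not_simpleOverlap_gad (hK : 0 < K) : ¬ SimpleOverlap (gad K) := by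
  intro hS
  have h0 : 0 < 2 * K := by omega
  have h1 : 1 < 2 * K := by omega
  have hne : (⟨0, h0⟩ : Fin (2 * K)) ≠ ⟨1, h1⟩ := by simp
  have hh0 : half K ⟨0, h0⟩ = ⟨0, hK⟩ := Fin.ext (by simp [half])
  have hh1 : half K ⟨1, h1⟩ = ⟨0, hK⟩ := Fin.ext (by simp [half])
  have hsub : ({av K (⟨0, hK⟩, 0), av K (⟨0, hK⟩, 1)} : Finset (Fin (6 * K))) ⊆
      varSet (gad K) ⟨0, h0⟩ ∩ varSet (gad K) ⟨1, h1⟩ := by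
    intro v hv
    rw [mem_insert, mem_singleton] at hv
    rw [mem_inter, mem_varSet_iff, mem_varSet_iff, hh0, hh1]
    rcases hv with rfl | rfl
    · exact ⟨Or.inr (Or.inr (Or.inl rfl)), Or.inr (Or.inr (Or.inl rfl))⟩
    · exact ⟨Or.inr (Or.inr (Or.inr rfl)), Or.inr (Or.inr (Or.inr rfl))⟩
  have hcard : ({av K (⟨0, hK⟩, 0), av K (⟨0, hK⟩, 1)} : Finset (Fin (6 * K))).card = 2 := by
    rw [card_pair]
    intro h
    simp only [av, Fin.mk.injEq] at h
    simp at h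
  have := (card_le_card hsub).trans (hS _ _ hne)
  omega

end Summit.PneNP.PneNP.Theorems.PstarGapLemmaRefutation
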